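import Literature.MathematicalPhysics.QuantumFieldTheory.Balaban1983to89.B9Eq342GreenPrimeTowerGradientRowDiagonal
import Literature.MathematicalPhysics.QuantumFieldTheory.Balaban1983to89.B9Eq342GreenPrimeTowerDecayRowClosed

/-!
# `Balaban1983to89.B9Eq342GreenPrimeTowerGradientRowClosed` — T. Bałaban, *Propagators for lattice gauge theories in a background field*, Commun. Math.
# Phys. **99** (1985) 389–434 [Balaban1985BackgroundPropagators] Thm 3.1 (3.42) p. 397, SECOND ENTRY («there exist positive constants M₁, δ₀, α₀, B₀ dependent
# on d and L only»), FOR PRINT's `G′_k(U)`: **THE COVARIANT-GRADIENT ROW CLOSED AT THE TOWER — `∃ α₂ B κ′ > 0` BEFORE THE HEIGHT such that on print's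
# diagonal window, in the cell's small-gauge MODEL with (3.35)'s two sizes sharing one `α` (`‖U(b) − 1‖ ≤ αη`, `‖U(x,μ) − U(x−e_μ,μ)‖ ≤ αη²`, `α ≤ α₂`), for every
# source `f` supported in ONE big block `v` with `‖f‖_∞ ≤ F` and every fine bond `b`: `‖(∇^η_UG′_k(U)f)(b)‖ ≤ B·F·e^{−κ′·d_m(Πb₊, v)}`** — the OWNER's
# `B9Eq342GreenPrimeTowerGradientRowDiagonal` (§2 of the gradient row) ∘ `B9Eq342GreenPrimeTowerDecayRowClosed.exists_decayRow_GpOfUk` (its value-row letter)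

statement-level skeleton of published theorems with citation tags; proofs where landed; nothing here is a claim about the Yang–Mills mass gap

CITATION HEADER (lean-in-tree rule).  Audit cell `pub-balaban`, sub-cell `t4`, BINDER row NE9; filed by the NE9 OWNER lineage `b2b-balaban-t4-ne9-p1` (gen 95).
SOURCE READ first-hand in the held text layer [Balaban1985BackgroundPropagators] (`paper:balaban1985-cmp99-background-propagators`): p. 396 (3.35); p. 397 Thm 3.1
and (3.42) (second member); p. 398 («invariant with respect to gauge transformations of U»; «random walk representation» — NOT reproduced).  [folklore]
quantifier bookkeeping BY NAME; nothing printed is a hypothesis except the model letters; the `[cite: …]` tags are TEXT LOCATIONS.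

WHAT IS PROVED (sorry-free; proof lane — no `def`).  **`exists_gradRow_GpOfUk`** — with `(α₁, C, ρ, κ′)` of `exists_decayRow_GpOfUk`: `κ₀ := κ′`,
`m_c := max(2, 4d(cosh κ′ − 1))`, `α₂ := min(α₁, √m_c∕(D₀ + 1))` (`D₀ = 2·2M_φM_φ′(e^{κ′}+1)d(3√2 + 4 sinh κ′)`, so that the smallness window holds for every
`α ≤ α₂`), `B := 2e^{κ′}·2C₁·(1 + (|a′| + m_c)C_u + d(2M_φM_φ′α₂ + (2M_φM_φ′α₂)²)C_u + (M_φM_φ′α₂m_c∕κ′)C_u)` with `C_u` the decayed value row's closed constant and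
`C₁ = (3√2 + 4 sinh κ′)∕√m_c`; then `norm_covDeriv_GpOfUk_le_blockLetter_diagonal` at `α′ := α` and monotonicity in `α ≤ α₂`.
HONEST SCOPE.  DISPLAYED in the `∃`-first statement: print's diagonal (`ηL^{n+1} = 1`, `c₀(L^{n+1})^d = c₁`, `2 ≤ L`, `1 ≤ d`), the MODEL letters (`hRS`, `U(b) ∈ U1`,
`star U = U⁻¹`, `‖U(b)−1‖ ≤ αη`, `‖U(x,μ)−U(x−e_μ,μ)‖ ≤ αη²`, the geometric level profile `ε_j ≤ αr^j` in `U1` with contractive transporters), ANY `hpos′`, every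
big-block family; the constants `α₂, B, κ′` depend on `(d, L?, a′, M_φ, M_φ′, r)` through the named suppliers only — NOT on `n, η, m, c₀, c₁, U` (in fact not on `L`
beyond the suppliers' own `∃`); crude, not valued.  Whether print's class (3.35) admits the global small gauge is the model's matter («WALLED ON A MODEL»); nothing of
[B9] Thm 3.1∕3.3∕3.11 asserted beyond what the named files prove on the cell's MODEL.  NOT summit progress (cell pub-balaban: NE9 NOT PRINTED ∕ NOT PROVED; «NE9 ⇐
the named binders»; row WALLED ON A MODEL (O-NE9-1; #5 UNRULED); spine PROVED 0∕9; rung (B)+1 on a finite T⁴ — NOT infinite volume, NOT mass gap, NOT BetaPertH, NOT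
Clay).  HONEST DEPENDENCY (cell line): continuum YM on T⁴ ⇐ BetaPertH ∧ nine spine estimates (0/9 proved); BetaPertH ⇐ (D1) ∧ (D4) ∧ CAP+tail; G-an2-4 gates
asym, D1 and NE2/3/4.  NEW file; nothing modified.  Net new unproved facts: 0.
-/

noncomputable section

set_option autoImplicit false

open scoped BigOperators InnerProductSpace

namespace Literature.MathematicalPhysics.QuantumFieldTheory.Balaban1983to89.B9Eq342GreenPrimeTowerGradientRowClosed

open B4Sect5Torus (TSite tdist)
open B4Sect5Proof (latticeConst latticeConst_nonneg)
open B7Prop1Explicit (U1)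
open B9SectCLatticeCarrier (Bond bpos btgt shift unshift)
open B9Eq311L2Pairing (WL2)
open B11Eq103H1Complex (SiteL2K covLaplaceSiteK covDerivL2K)
open B9Eq310HessianOperator (adTransportW)
open B9Eq319QprimeTorus (fineP blockCoord)
open B9Eq315QTower (towerP UlevOf)
open B9Eq316TowerFlatIsOneStep (towerP_eq_fineP_pow siteCast)
open B9Eq324DeltaPrimeATower (laplacePrimeAk GpOfUk)
open B9Eq342GreenPrimeSupBound (norm_adTransportW_eq norm_adTransportW_inv_eq)
open B9Eq342GreenPrimeTowerGradientRowDiagonal (norm_covDeriv_GpOfUk_le_blockLetter_diagonal)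
open B9Eq342GreenPrimeTowerDecayRowClosed (exists_decayRow_GpOfUk)

variable {d : ℕ} (L : ℕ) [NeZero L] {𝔸 : Type*} [NormedRing 𝔸] [NormedAlgebra ℂ 𝔸] [CompleteSpace 𝔸] [NormOneClass 𝔸] [StarRing 𝔸]
  {W : Type*} [NormedAddCommGroup W] [InnerProductSpace ℂ W] [FiniteDimensional ℂ W] (φ : W ≃ₗ[ℂ] 𝔸) {a' Mφ Mφ' : ℝ}
  (hMφ : 0 ≤ Mφ) (hMφ' : 0 ≤ Mφ') (hφn : ∀ w, ‖φ w‖ ≤ Mφ * ‖w‖) (hφn' : ∀ X, ‖φ.symm X‖ ≤ Mφ' * ‖X‖) (ha' : 0 < a')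
  {r : ℝ} (hr0 : 0 ≤ r) (hr1 : r < 1)
  (τ : 𝔸 →ₗ[ℂ] ℂ) (hτ₂ : ∀ X Y : 𝔸, τ (X * Y) = τ (Y * X)) (hφτ : ∀ X Y : 𝔸, ⟪φ.symm X, φ.symm Y⟫_ℂ = τ (star X * Y))

/-- monotonicity of the diagonal constant's bracket in the model size `α`. [folklore] -/
private theorem bracket_mono {A Mc d M α α₂ Cu Q : ℝ} (hd : 0 ≤ d) (hM : 0 ≤ M) (hα : 0 ≤ α) (hαα : α ≤ α₂) (hCu : 0 ≤ Cu) (hQ : 0 ≤ Q) :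
    1 + (A + Mc) * Cu + d * (M * α + (M * α) * (M * α)) * Cu + (Q * α) * Cu ≤
      1 + (A + Mc) * Cu + d * (M * α₂ + (M * α₂) * (M * α₂)) * Cu + (Q * α₂) * Cu := by
  have h1 : M * α ≤ M * α₂ := mul_le_mul_of_nonneg_left hαα hM
  have h0 : 0 ≤ M * α := mul_nonneg hM hα
  have h2 : (M * α) * (M * α) ≤ (M * α₂) * (M * α₂) := mul_le_mul h1 h1 h0 (h0.trans h1)
  have h3 : Q * α ≤ Q * α₂ := mul_le_mul_of_nonneg_left hαα hQ
  have h4 : d * (M * α + (M * α) * (M * α)) * Cu ≤ d * (M * α₂ + (M * α₂) * (M * α₂)) * Cu :=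
    mul_le_mul_of_nonneg_right (mul_le_mul_of_nonneg_left (add_le_add h1 h2) hd) hCu
  have h5 : (Q * α) * Cu ≤ (Q * α₂) * Cu := mul_le_mul_of_nonneg_right h3 hCu
  linarith

include hMφ hMφ' hφn hφn' ha' hr0 hr1 hτ₂ hφτ in
/-- **THE COVARIANT-GRADIENT ROW OF (3.42) FOR `G′_k(U)` CLOSED AT THE TOWER: `∃ α₂ B κ′` BEFORE THE HEIGHT** (`1 ≤ d`, `2 ≤ L`; `M_φM_φ′`, `a′ > 0`, the profile
ratio `r ∈ [0,1[`, a `*`-trace compatible with the fibre norm given): at every height `n`, on print's diagonal `ηL^{n+1} = 1`, `c₀(L^{n+1})^d = c₁`, every period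
`m`, every background with `hRS`, `U(b) ∈ U1`, `star U(b) = U(b)⁻¹`, `‖U(b) − 1‖ ≤ αη` AND the bond-gradient datum `‖U(x,μ) − U(x−e_μ,μ)‖ ≤ αη²` (`α ≤ α₂`), level
averages `‖Ū^j(b) − 1‖ ≤ ε_j ≤ αr^j` in `U1` with contractive transporters, ANY `hpos′`, every big-block family `P`, every big block `v`, every `f` supported in
`Π⁻¹(v)` with `‖f(x)‖ ≤ F` (`0 ≤ F`), every fine bond `b`: `‖(∇^η_UG′_k(U)f)(b)‖ ≤ B·F·e^{−κ′·d_m(Πb₊, v)}`.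
[cite: Balaban1985BackgroundPropagators, Thm 3.1 (3.42) p.397, (3.35) p.396, (3.49) p.399] -/
theorem exists_gradRow_GpOfUk (hd : 1 ≤ d) (hL2 : 2 ≤ L) :
    ∃ α₂ B κ' : ℝ, 0 < α₂ ∧ 0 ≤ B ∧ 0 < κ' ∧
      ∀ (n : ℕ) (η : ℝ), η * (L : ℝ) ^ (n + 1) = 1 →
      ∀ (c₀ c₁ : ℝ) [Fact (0 < c₀)] [Fact (0 < c₁)], c₀ * ((L : ℝ) ^ (n + 1)) ^ d = c₁ →
      ∀ (m : Fin d → ℕ) [∀ i, NeZero (m i)] (U : Bond d (towerP L m (n + 1)) → 𝔸ˣ),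
        (∀ (b : Bond d (towerP L m (n + 1))) (v u : W), ⟪adTransportW φ U b v, u⟫_ℂ = ⟪v, adTransportW φ (fun b => (U b)⁻¹) b u⟫_ℂ) →
      ∀ (α : ℝ), 0 ≤ α → α ≤ α₂ → (∀ b, U b ∈ U1 𝔸) → (∀ b, ‖(U b : 𝔸) - 1‖ ≤ α * η) →
        (∀ (x : TSite d (towerP L m (n + 1))) (μ : Fin d), ‖(U (x, μ) : 𝔸) - (U (unshift μ x, μ) : 𝔸)‖ ≤ α * η ^ 2) →
      ∀ (εU : ℕ → ℝ), (∀ j, 0 ≤ εU j) → (∀ j < n + 1, εU j ≤ α * r ^ j) →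
        (∀ (j : ℕ) (b : Bond d (towerP L m (j + 1))), ‖(UlevOf L m (n + 1) U j b : 𝔸) - 1‖ ≤ εU j) →
        (∀ (j : ℕ) (b : Bond d (towerP L m (j + 1))), UlevOf L m (n + 1) U j b ∈ U1 𝔸) →
        (∀ b, star (U b : 𝔸) = ((U b)⁻¹ : 𝔸ˣ)) →
        (∀ (j : ℕ) (b : Bond d (towerP L m (j + 1))) (w : W), ‖adTransportW φ (UlevOf L m (n + 1) U j) b w‖ ≤ ‖w‖) →
      ∀ (hpos' : ∀ x : SiteL2K ℂ d (towerP L m (n + 1)) c₀ W, x ≠ 0 → 0 < RCLike.re ⟪x, laplacePrimeAk L m n φ η U a' (c₁ := c₁) x⟫_ℂ)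
        (PS : TSite d m → SiteL2K ℂ d (towerP L m (n + 1)) c₀ W →L[ℂ] SiteL2K ℂ d (towerP L m (n + 1)) c₀ W),
        (∀ (y : TSite d m) (f : SiteL2K ℂ d (towerP L m (n + 1)) c₀ W) (x : TSite d (towerP L m (n + 1))),
          WL2.equiv ℂ (fun _ : TSite d (towerP L m (n + 1)) => c₀) W (PS y f) x =
            if blockCoord (L ^ (n + 1)) m (siteCast (towerP_eq_fineP_pow L m (n + 1)) x) = y then
              WL2.equiv ℂ (fun _ : TSite d (towerP L m (n + 1)) => c₀) W f x else 0) →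
      ∀ (v : TSite d m) (f : SiteL2K ℂ d (towerP L m (n + 1)) c₀ W) (F : ℝ), 0 ≤ F →
        (∀ x, blockCoord (L ^ (n + 1)) m (siteCast (towerP_eq_fineP_pow L m (n + 1)) x) ≠ v →
          WL2.equiv ℂ (fun _ : TSite d (towerP L m (n + 1)) => c₀) W f x = 0) →
        (∀ y, ‖WL2.equiv ℂ (fun _ : TSite d (towerP L m (n + 1)) => c₀) W f y‖ ≤ F) →
      ∀ (bnd : Bond d (towerP L m (n + 1))),
        ‖WL2.equiv ℂ (fun _ : Bond d (towerP L m (n + 1)) => c₀) W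
            (covDerivL2K ℂ c₀ ((η : ℂ))⁻¹ (adTransportW φ U) (GpOfUk L m n φ η U a' (c₁ := c₁) hpos' f)) bnd‖ ≤
          B * F * Real.exp (-(κ' * tdist m (blockCoord (L ^ (n + 1)) m (siteCast (towerP_eq_fineP_pow L m (n + 1)) (btgt bnd))) v)) := by
  obtain ⟨α₁, C, ρ, κ', hα₁, hC, hρ, hκ', hκ'ρ, h2κ, hrow⟩ := exists_decayRow_GpOfUk L φ (a' := a') hMφ hMφ' hφn hφn' ha' hr0 hr1 τ hτ₂ hφτ hd
  -- the closed letters: the decayed value row's constant, the comparison mass, the smallness threshold, the bound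
  set Cu : ℝ := (1 + |a'| * C) * (Real.exp (1 / 2) * 2) * (∑ l ∈ Finset.range d, (2 : ℝ) ^ (l + 1)) +
    Real.sqrt (3 ^ d * 2 ^ d) * Real.sqrt ((Real.exp (1 / 2) * 2) * latticeConst d (Real.sqrt (1 / (4 * d + 1)) - 2 * κ')) * C with hCu_def
  have hCu : 0 ≤ Cu := by positivity
  set mc : ℝ := max 2 (4 * (d : ℝ) * (Real.cosh κ' - 1)) with hmc_def
  have hmc2 : 2 ≤ mc := le_max_left _ _
  have hwin4 : 4 * (d : ℝ) * (Real.cosh κ' - 1) ≤ mc := le_max_right _ _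
  have hmc : 0 < mc := by linarith
  have hsinh : 0 ≤ Real.sinh κ' := Real.sinh_nonneg_iff.2 hκ'.le
  set D₀ : ℝ := 2 * (2 * Mφ * Mφ') * (Real.exp κ' + 1) * (d : ℝ) * ((1 + 2 / 1) * Real.sqrt 2 + 4 * Real.sinh κ') with hD₀_def
  have hD₀ : 0 ≤ D₀ := by positivity
  set α₂ : ℝ := min α₁ (Real.sqrt mc / (D₀ + 1)) with hα₂_def
  have hα₂ : 0 < α₂ := lt_min hα₁ (by positivity)
  have hα₂1 : α₂ ≤ α₁ := min_le_left _ _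
  have hα₂s : α₂ ≤ Real.sqrt mc / (D₀ + 1) := min_le_right _ _
  set C₁ : ℝ := ((1 + 2 / 1) * Real.sqrt 2 + 4 * Real.sinh κ') / Real.sqrt mc with hC₁_def
  have hC₁ : 0 ≤ C₁ := by positivity
  set B : ℝ := 2 * Real.exp κ' * (2 * C₁ *
    (1 + (|a'| + mc) * Cu + (d : ℝ) * (2 * Mφ * Mφ' * α₂ + (2 * Mφ * Mφ' * α₂) * (2 * Mφ * Mφ' * α₂)) * Cu +
      (Mφ * Mφ' * α₂ * mc / κ') * Cu)) with hB_def
  have hB : 0 ≤ B := by positivity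
  refine ⟨α₂, B, κ', hα₂, hB, hκ', ?_⟩
  intro n η hηL c₀ c₁ _ _ hdiag m _ U hRS α hα hαle hUb hUε hUa εU hεU hεg hLε hLb hUstar hRlev hpos' PS hPS v f F hF0 hfv hF bnd
  -- the smallness window at this `α`
  have hsmall : 2 * ((2 * Mφ * Mφ' * α) * (Real.exp κ' + 1) * (d : ℝ) * ((1 + 2 / 1) * Real.sqrt 2 + 4 * Real.sinh κ')) ≤ Real.sqrt mc := by
    have e : 2 * ((2 * Mφ * Mφ' * α) * (Real.exp κ' + 1) * (d : ℝ) * ((1 + 2 / 1) * Real.sqrt 2 + 4 * Real.sinh κ')) = D₀ * α := by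
      rw [hD₀_def]; ring
    rw [e]
    have hs : 0 ≤ Real.sqrt mc := Real.sqrt_nonneg _
    have h1 : D₀ * α ≤ D₀ * (Real.sqrt mc / (D₀ + 1)) := mul_le_mul_of_nonneg_left (hαle.trans hα₂s) hD₀
    have h2 : D₀ * (Real.sqrt mc / (D₀ + 1)) ≤ Real.sqrt mc := by
      rw [mul_div_assoc', div_le_iff₀ (by positivity)]
      calc D₀ * Real.sqrt mc ≤ (D₀ + 1) * Real.sqrt mc := mul_le_mul_of_nonneg_right (le_add_of_nonneg_right zero_le_one) hs
        _ = Real.sqrt mc * (D₀ + 1) := mul_comm _ _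
    exact h1.trans h2
  -- the decayed value row at this background (the `hudec` letter)
  have hudec : ∀ x, ‖WL2.equiv ℂ (fun _ : TSite d (towerP L m (n + 1)) => c₀) W (GpOfUk L m n φ η U a' (c₁ := c₁) hpos' f) x‖ ≤
      Cu * F * Real.exp (-(κ' * tdist m (blockCoord (L ^ (n + 1)) m (siteCast (towerP_eq_fineP_pow L m (n + 1)) x)) v)) := fun x => by
    have h := hrow n η hηL c₀ c₁ hdiag m U hRS α hα (hαle.trans hα₂1) hUb hUε εU hεU hεg hLε hLb hUstar hRlev hpos' PS hPS v x f F hfv hF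
    calc _ ≤ Cu * Real.exp (-(κ' * tdist m (blockCoord (L ^ (n + 1)) m (siteCast (towerP_eq_fineP_pow L m (n + 1)) x)) v)) * F := h
      _ = _ := mul_right_comm _ _ _
  -- §2 of the gradient row at `α′ := α`, `κ₀ := κ′`, `κ := κ′`
  have h := norm_covDeriv_GpOfUk_le_blockLetter_diagonal L m n φ hφn hφn' hMφ hMφ' U a' hpos' hUb hα hα hUε hUa hκ' hmc2 hd hL2 hηL hdiag
    (fun b w => (norm_adTransportW_eq φ U τ hτ₂ hUstar hφτ b w).le) (fun b w => (norm_adTransportW_inv_eq φ U τ hτ₂ hUstar hφτ b w).le) hRlev hPS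
    hwin4 hsmall v f hF0 hCu hκ'.le le_rfl hfv hF hudec bnd
  refine h.trans ?_
  -- monotonicity in `α ≤ α₂`
  have hE : 0 ≤ F * Real.exp (-(κ' * tdist m (blockCoord (L ^ (n + 1)) m (siteCast (towerP_eq_fineP_pow L m (n + 1)) (btgt bnd))) v)) :=
    by positivity
  have hY := bracket_mono (A := |a'|) (Mc := mc) (M := 2 * Mφ * Mφ') (Q := Mφ * Mφ' * mc / κ') (Cu := Cu) (by positivity : (0 : ℝ) ≤ d)
    (by positivity) hα hαle hCu (by positivity)
  have eQ : ∀ t : ℝ, Mφ * Mφ' * t * mc / κ' = Mφ * Mφ' * mc / κ' * t := fun t => by ring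
  rw [eQ α] 
  rw [hB_def, eQ α₂]
  have hmono : 2 * Real.exp κ' * (2 * C₁ * (1 + (|a'| + mc) * Cu +
      (d : ℝ) * (2 * Mφ * Mφ' * α + (2 * Mφ * Mφ' * α) * (2 * Mφ * Mφ' * α)) * Cu + (Mφ * Mφ' * mc / κ' * α) * Cu)) ≤
      2 * Real.exp κ' * (2 * C₁ * (1 + (|a'| + mc) * Cu +
      (d : ℝ) * (2 * Mφ * Mφ' * α₂ + (2 * Mφ * Mφ' * α₂) * (2 * Mφ * Mφ' * α₂)) * Cu + (Mφ * Mφ' * mc / κ' * α₂) * Cu)) :=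
    mul_le_mul_of_nonneg_left (mul_le_mul_of_nonneg_left hY (by positivity)) (by positivity)
  calc _ = 2 * Real.exp κ' * (2 * C₁ * (1 + (|a'| + mc) * Cu +
      (d : ℝ) * (2 * Mφ * Mφ' * α + (2 * Mφ * Mφ' * α) * (2 * Mφ * Mφ' * α)) * Cu + (Mφ * Mφ' * mc / κ' * α) * Cu)) *
      (F * Real.exp (-(κ' * tdist m (blockCoord (L ^ (n + 1)) m (siteCast (towerP_eq_fineP_pow L m (n + 1)) (btgt bnd))) v))) := by
        rw [hC₁_def]; ring
    _ ≤ 2 * Real.exp κ' * (2 * C₁ * (1 + (|a'| + mc) * Cu +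
      (d : ℝ) * (2 * Mφ * Mφ' * α₂ + (2 * Mφ * Mφ' * α₂) * (2 * Mφ * Mφ' * α₂)) * Cu + (Mφ * Mφ' * mc / κ' * α₂) * Cu)) *
      (F * Real.exp (-(κ' * tdist m (blockCoord (L ^ (n + 1)) m (siteCast (towerP_eq_fineP_pow L m (n + 1)) (btgt bnd))) v))) :=
        mul_le_mul_of_nonneg_right hmono hE
    _ = _ := by ring

end Literature.MathematicalPhysics.QuantumFieldTheory.Balaban1983to89.B9Eq342GreenPrimeTowerGradientRowClosed

end
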